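import Literature.Analysis.Complex.CahenMellinDirichlet
import Literature.Analysis.Complex.HorizontalStripResidues
import HarnessLib

/-!
# Residue theorem between two vertical lines for `h(z)/sin(πz)` and `h(z) cot(πz)`

Topic `Literature/Analysis/Complex` (contour integration), the vertical companion of
`Literature.Analysis.Complex.integral_slant_div_sin_sub_eq_sum` (`HorizontalStripResidues.lean`),
built on the residue theorem for a vertical strip
`Literature.Analysis.Complex.integral_vertical_sub_eq_sum_of_simplePoles`
(`CahenMellinDirichlet.lean`). Everything here is PROVED; no definitions, no named facts.

* `integral_vertical_div_sin_sub_eq_sum` — for real non-integers `c₁ < c₂` and `h` holomorphic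
  near the closed strip `c₁ ≤ re z ≤ c₂`, with `f = h / sin(π·)` integrable on both lines and
  uniformly small on the cross-sections:
  `∫ f(c₂ + iy) dy − ∫ f(c₁ + iy) dy = 2 Σ_{c₁ < n < c₂} (−1)ⁿ h(n)`
  (the poles are the integers `n`, simple, with residues `(−1)ⁿ h(n)/π`);
* `integral_vertical_mul_cot_sub_eq_sum` — the same for `f = h · cot(π·)` (apply the previous one
  to `h cos(π·)`): `∫ f(c₂ + iy) − ∫ f(c₁ + iy) = 2 Σ_{c₁ < n < c₂} h(n)`.

These are the finite-strip forms of the classical "cotangent summation" of series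
`Σ h(n) = −½ ∫ h(c+iy) cot(π(c+iy)) dy` used to turn hypergeometric-type sums into Barnes
integrals (e.g. Zudilin, Izv. Math. 66 (2002), §4 Lemma 2: `Σ_t R^{(b-1)}(t)/(b-1)! =
−(1/2πi)∫ π^b cot_b(πt) R(t) dt`); the passage `c₂ → +∞` is done by the user with the decay at
hand. Standard textbook material (Lindelöf, *Le calcul des résidus*, Ch. III); tagged folklore.
-/

noncomputable section

open _root_.Complex Set MeasureTheory Filter intervalIntegral Real
open scoped _root_.Topology

namespace Literature.Analysis.Complex

/-- **Residue theorem between two vertical lines, for `h(z)/sin(πz)`.** Let `c₁ < c₂` be real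
non-integers, `U` an open neighbourhood of the closed strip `{c₁ ≤ re z ≤ c₂}` and `h`
complex differentiable on `U`. Put `f = h / sin(π ·)`; its poles in the strip are the integers
`n ∈ (c₁, c₂)`, simple, with residues `(-1)ⁿ h(n)/π`. If `y ↦ f(c_j + iy)` is integrable
(`j = 1,2`) and `f(x + iT) → 0` as `|T| → ∞` uniformly in `x ∈ [c₁,c₂]`, then
`∫ f(c₂ + iy) dy − ∫ f(c₁ + iy) dy = 2 Σ_{c₁ < n < c₂} (-1)ⁿ h(n)`. [folklore] -/
theorem integral_vertical_div_sin_sub_eq_sum {h : ℂ → ℂ} {c₁ c₂ : ℝ} (hc : c₁ < c₂)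
    (hc₁ : ∀ n : ℤ, (n : ℝ) ≠ c₁) (hc₂ : ∀ n : ℤ, (n : ℝ) ≠ c₂)
    (U : Set ℂ) (hU : IsOpen U) (hKU : re ⁻¹' Icc c₁ c₂ ⊆ U)
    (hh : DifferentiableOn ℂ h U)
    (h₁ : Integrable fun y : ℝ ↦ h (c₁ + y * I) / Complex.sin (π * (c₁ + y * I)))
    (h₂ : Integrable fun y : ℝ ↦ h (c₂ + y * I) / Complex.sin (π * (c₂ + y * I)))
    (hdecay : ∀ ε : ℝ, 0 < ε → ∃ T₀ : ℝ, ∀ T : ℝ, T₀ ≤ |T| → ∀ x ∈ Icc c₁ c₂,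
        ‖h (x + T * I) / Complex.sin (π * (x + T * I))‖ ≤ ε) :
    (∫ y : ℝ, h (c₂ + y * I) / Complex.sin (π * (c₂ + y * I)))
      - ∫ y : ℝ, h (c₁ + y * I) / Complex.sin (π * (c₁ + y * I)) =
      2 * ∑ n ∈ Finset.Ioc ⌊c₁⌋ ⌊c₂⌋, (-1) ^ n * h n := by
  classical
  set g : ℂ → ℂ := fun z ↦ Complex.sin (π * z) with hg
  set f : ℂ → ℂ := fun z ↦ h z / g z with hf
  -- the poles and the residues
  set S : Finset ℂ := (Finset.Ioc ⌊c₁⌋ ⌊c₂⌋).image (fun n : ℤ ↦ (n : ℂ)) with hSdef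
  set r : ℂ → ℂ := fun p ↦ h p / (π * Complex.cos (π * p)) with hr
  have hIoc : ∀ n : ℤ, n ∈ Finset.Ioc ⌊c₁⌋ ⌊c₂⌋ ↔ c₁ < n ∧ (n : ℝ) < c₂ := by
    intro n
    rw [Finset.mem_Ioc, Int.floor_lt, Int.le_floor]
    exact ⟨fun ⟨h1, h2⟩ ↦ ⟨h1, lt_of_le_of_ne h2 (hc₂ n)⟩, fun ⟨h1, h2⟩ ↦ ⟨h1, h2.le⟩⟩
  -- a slightly larger open strip free of other integers
  obtain ⟨c₁', hc₁'1, hc₁'2⟩ : ∃ c₁' : ℝ, c₁' < c₁ ∧ ∀ n : ℤ, c₁' < n → c₁ < n := by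
    refine ⟨(⌊c₁⌋ + c₁) / 2, ?_, fun n hn ↦ ?_⟩
    · have h3 : (⌊c₁⌋ : ℝ) < c₁ := lt_of_le_of_ne (Int.floor_le c₁) (hc₁ _)
      linarith
    · have h1 : (⌊c₁⌋ : ℝ) ≤ c₁ := Int.floor_le c₁
      have h5 : ⌊c₁⌋ < n := by exact_mod_cast (show (⌊c₁⌋ : ℝ) < n by linarith)
      have h8 : ((⌊c₁⌋ + 1 : ℤ) : ℝ) ≤ n := by exact_mod_cast h5
      have h7 : c₁ < (⌊c₁⌋ : ℝ) + 1 := Int.lt_floor_add_one c₁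
      push_cast at h8
      linarith
  obtain ⟨c₂', hc₂'1, hc₂'2⟩ : ∃ c₂' : ℝ, c₂ < c₂' ∧ ∀ n : ℤ, (n : ℝ) < c₂' → (n : ℝ) < c₂ := by
    refine ⟨(⌊c₂⌋ + 1 + c₂) / 2, ?_, fun n hn ↦ ?_⟩
    · have h7 : c₂ < (⌊c₂⌋ : ℝ) + 1 := Int.lt_floor_add_one c₂
      linarith
    · have h7 : c₂ < (⌊c₂⌋ : ℝ) + 1 := Int.lt_floor_add_one c₂
      have h5 : n < ⌊c₂⌋ + 1 := by exact_mod_cast (show (n : ℝ) < ⌊c₂⌋ + 1 by linarith)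
      have h8 : (n : ℝ) ≤ ⌊c₂⌋ := by exact_mod_cast Int.lt_add_one_iff.1 h5
      exact lt_of_le_of_ne (h8.trans (Int.floor_le c₂)) (hc₂ n)
  set W : Set ℂ := re ⁻¹' Ioo c₁' c₂' with hW
  have hWopen : IsOpen W := isOpen_Ioo.preimage Complex.continuous_re
  set U₀ : Set ℂ := U ∩ W with hU₀
  have hU₀open : IsOpen U₀ := hU.inter hWopen
  have hKU₀ : re ⁻¹' Icc c₁ c₂ ⊆ U₀ := fun z hz ↦
    ⟨hKU hz, ⟨hc₁'1.trans_le hz.1, hz.2.trans_lt hc₂'1⟩⟩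
  -- zeros of `g` in `U₀` are the poles
  have hgzero : ∀ z ∈ U₀, g z = 0 → z ∈ (S : Set ℂ) := by
    intro z hz hgz
    obtain ⟨n, rfl⟩ := (sin_pi_mul_eq_zero_iff z).1 hgz
    have hzW := hz.2
    simp only [hW, mem_preimage, mem_Ioo, Complex.intCast_re] at hzW
    exact Finset.mem_coe.2 (Finset.mem_image.2 ⟨n, (hIoc n).2 ⟨hc₁'2 n hzW.1, hc₂'2 n hzW.2⟩, rfl⟩)
  have hgd : Differentiable ℂ g := fun z ↦
    ((Complex.hasDerivAt_sin (π * z)).comp z ((hasDerivAt_id z).const_mul (π : ℂ))).differentiableAt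
  have hfd : DifferentiableOn ℂ f (U₀ \ ↑S) := by
    intro z hz
    have hgz : g z ≠ 0 := fun h0 ↦ hz.2 (hgzero z hz.1 h0)
    exact ((hh z hz.1.1).mono (fun w hw ↦ hw.1.1)).div (hgd z).differentiableWithinAt hgz
  have hSmem : ∀ p ∈ S, p.re ∈ Ioo c₁ c₂ := by
    intro p hp
    obtain ⟨n, hn, rfl⟩ := Finset.mem_image.1 hp
    simpa using (hIoc n).1 hn
  -- simple poles: `f = (h / dslope g n) / (z - n)` near an integer `n`
  have hpole : ∀ p ∈ S, ∃ φ : ℂ → ℂ, ∃ V ∈ 𝓝 p, DifferentiableOn ℂ φ V ∧ φ p = r p ∧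
      ∀ z ∈ V, z ≠ p → f z = φ z / (z - p) := by
    intro p hp
    obtain ⟨n, hn, rfl⟩ := Finset.mem_image.1 hp
    have hder : HasDerivAt g (π * (-1) ^ n) (n : ℂ) := hasDerivAt_sin_pi_mul_int n
    have hgn : g n = 0 := (sin_pi_mul_eq_zero_iff _).2 ⟨n, rfl⟩
    have hdsn : dslope g n n = π * (-1) ^ n := by rw [dslope_same, hder.deriv]
    have hne : dslope g n n ≠ 0 := by
      rw [hdsn]
      exact mul_ne_zero (ofReal_ne_zero.2 Real.pi_ne_zero) (zpow_ne_zero _ (by norm_num))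
    have hcont : ContinuousAt (dslope g n) n := continuousAt_dslope_same.2 (hgd n)
    obtain ⟨V, hVmem, hVopen, hVsub⟩ : ∃ V : Set ℂ, (n : ℂ) ∈ V ∧ IsOpen V ∧
        V ⊆ U₀ ∩ {z | dslope g n z ≠ 0} := by
      have h1 : U₀ ∩ {z | dslope g n z ≠ 0} ∈ 𝓝 (n : ℂ) := by
        refine inter_mem (hU₀open.mem_nhds (hKU₀ ?_))
          (hcont.preimage_mem_nhds (isOpen_ne.mem_nhds hne))
        have := hSmem n hp
        exact ⟨this.1.le, this.2.le⟩
      obtain ⟨V, hV1, hV2, hV3⟩ := mem_nhds_iff.1 h1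
      exact ⟨V, hV3, hV2, hV1⟩
    refine ⟨fun z ↦ h z / dslope g n z, V, hVopen.mem_nhds hVmem, ?_, ?_, ?_⟩
    · have hdsd : DifferentiableOn ℂ (dslope g n) V :=
        (differentiableOn_dslope (hVopen.mem_nhds hVmem)).2 hgd.differentiableOn
      exact (hh.mono fun z hz ↦ (hVsub hz).1.1).div hdsd fun z hz ↦ (hVsub hz).2
    · simp only [hr, hdsn]
      rw [mul_comm (π : ℂ) ((n : ℤ) : ℂ), cos_int_mul_pi_complex n]
    · intro z hz hzn
      have hds : dslope g n z = g z / (z - n) := by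
        rw [dslope_of_ne _ hzn, slope_def_field, hgn, sub_zero]
      simp only [hf, hds]
      have hzn' : z - n ≠ 0 := sub_ne_zero.2 hzn
      have hgz : g z ≠ 0 := by
        intro h0
        have := (hVsub hz).2
        simp only [mem_setOf_eq, hds, h0, zero_div, ne_eq, not_true_eq_false] at this
      field_simp
  have hmain := integral_vertical_sub_eq_sum_of_simplePoles hc S r U₀ hU₀open hKU₀ hSmem hfd
    hpole h₁ h₂ hdecay
  rw [hmain, hSdef, Finset.sum_image (fun m _ n _ h ↦ by exact_mod_cast h)]
  have hπ : (π : ℂ) ≠ 0 := ofReal_ne_zero.2 Real.pi_ne_zero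
  rw [Finset.mul_sum, Finset.mul_sum]
  refine Finset.sum_congr rfl fun n _ ↦ ?_
  simp only [hr]
  rw [mul_comm (π : ℂ) ((n : ℤ) : ℂ), cos_int_mul_pi_complex n]
  have hu : ((-1 : ℂ) ^ n) * ((-1 : ℂ) ^ n) = 1 := by
    rw [← mul_zpow, neg_one_mul, neg_neg, one_zpow]
  have hu0 : ((-1 : ℂ) ^ n) ≠ 0 := zpow_ne_zero _ (by norm_num)
  have key : h n / (π * (-1) ^ n) = (-1) ^ n * h n / π := by
    rw [div_eq_div_iff (mul_ne_zero hπ hu0) hπ]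
    linear_combination (-(π * h n)) * hu
  rw [key]
  field_simp

/-- `cos(πz)/sin(πz) = cot(πz)`; we spell `cot` as the quotient throughout. For an integer `n`,
`(-1)ⁿ (h(n) cos(πn)) = h(n)`. [folklore] -/
theorem neg_one_zpow_mul_mul_cos_int_mul_pi (h : ℂ → ℂ) (n : ℤ) :
    (-1 : ℂ) ^ n * (h n * Complex.cos (π * n)) = h n := by
  rw [mul_comm (π : ℂ) (n : ℂ), cos_int_mul_pi_complex n]
  have hu : ((-1 : ℂ) ^ n) * ((-1 : ℂ) ^ n) = 1 := by
    rw [← mul_zpow, neg_one_mul, neg_neg, one_zpow]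
  linear_combination (h n) * hu

/-- **Residue theorem between two vertical lines, for `h(z) cot(πz)`** (written as
`h(z) cos(πz)/sin(πz)`). With `c₁ < c₂` real non-integers, `U ⊇ {c₁ ≤ re z ≤ c₂}` open and `h`
differentiable on `U`, `f = h cos(π·)/sin(π·)` integrable on both lines and uniformly small on the
cross-sections: `∫ f(c₂ + iy) dy − ∫ f(c₁ + iy) dy = 2 Σ_{c₁ < n < c₂} h(n)` (the poles of
`π cot(πz)` are the integers, simple with residue `1`). [folklore] -/
theorem integral_vertical_mul_cot_sub_eq_sum {h : ℂ → ℂ} {c₁ c₂ : ℝ} (hc : c₁ < c₂)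
    (hc₁ : ∀ n : ℤ, (n : ℝ) ≠ c₁) (hc₂ : ∀ n : ℤ, (n : ℝ) ≠ c₂)
    (U : Set ℂ) (hU : IsOpen U) (hKU : re ⁻¹' Icc c₁ c₂ ⊆ U)
    (hh : DifferentiableOn ℂ h U)
    (h₁ : Integrable fun y : ℝ ↦ h (c₁ + y * I) * Complex.cos (π * (c₁ + y * I)) /
      Complex.sin (π * (c₁ + y * I)))
    (h₂ : Integrable fun y : ℝ ↦ h (c₂ + y * I) * Complex.cos (π * (c₂ + y * I)) /
      Complex.sin (π * (c₂ + y * I)))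
    (hdecay : ∀ ε : ℝ, 0 < ε → ∃ T₀ : ℝ, ∀ T : ℝ, T₀ ≤ |T| → ∀ x ∈ Icc c₁ c₂,
        ‖h (x + T * I) * Complex.cos (π * (x + T * I)) / Complex.sin (π * (x + T * I))‖ ≤ ε) :
    (∫ y : ℝ, h (c₂ + y * I) * Complex.cos (π * (c₂ + y * I)) / Complex.sin (π * (c₂ + y * I)))
      - ∫ y : ℝ, h (c₁ + y * I) * Complex.cos (π * (c₁ + y * I)) /
          Complex.sin (π * (c₁ + y * I)) =
      2 * ∑ n ∈ Finset.Ioc ⌊c₁⌋ ⌊c₂⌋, h n := by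
  have hcos : Differentiable ℂ fun z : ℂ ↦ Complex.cos (π * z) := fun z ↦
    ((Complex.hasDerivAt_cos (π * z)).comp z ((hasDerivAt_id z).const_mul (π : ℂ))).differentiableAt
  have hmain := integral_vertical_div_sin_sub_eq_sum (h := fun z ↦ h z * Complex.cos (π * z)) hc
    hc₁ hc₂ U hU hKU (hh.mul hcos.differentiableOn) h₁ h₂ hdecay
  rw [hmain]
  congr 1
  exact Finset.sum_congr rfl fun n _ ↦ neg_one_zpow_mul_mul_cos_int_mul_pi h n


/-! ### Elementary bounds for `sin`, `cos`, `cot` off the real axis -/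

/-- `‖sin z‖² = sin²(re z) + sinh²(im z)`. [folklore] -/
theorem norm_sin_sq_eq (z : ℂ) :
    ‖Complex.sin z‖ ^ 2 = Real.sin z.re ^ 2 + Real.sinh z.im ^ 2 := by
  have h : Complex.sin z = ((Real.sin z.re * Real.cosh z.im : ℝ) : ℂ) +
      ((Real.cos z.re * Real.sinh z.im : ℝ) : ℂ) * I := by
    rw [Complex.sin_eq]; push_cast; ring
  have hre : (Complex.sin z).re = Real.sin z.re * Real.cosh z.im := by
    rw [h]; simp only [Complex.add_re, Complex.mul_re, Complex.ofReal_re, Complex.ofReal_im,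
      Complex.I_re, Complex.I_im]; ring
  have him : (Complex.sin z).im = Real.cos z.re * Real.sinh z.im := by
    rw [h]; simp only [Complex.add_im, Complex.mul_im, Complex.ofReal_re, Complex.ofReal_im,
      Complex.I_re, Complex.I_im]; ring
  rw [Complex.sq_norm, Complex.normSq_apply, hre, him]
  have h1 := Real.cos_sq_add_sin_sq z.re
  have h2 : Real.cosh z.im ^ 2 = Real.sinh z.im ^ 2 + 1 := Real.cosh_sq z.im
  nlinarith [h1, h2]

/-- `‖cos z‖² = cos²(re z) + sinh²(im z)`. [folklore] -/
theorem norm_cos_sq_eq (z : ℂ) :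
    ‖Complex.cos z‖ ^ 2 = Real.cos z.re ^ 2 + Real.sinh z.im ^ 2 := by
  have h : Complex.cos z = ((Real.cos z.re * Real.cosh z.im : ℝ) : ℂ) +
      ((-(Real.sin z.re * Real.sinh z.im) : ℝ) : ℂ) * I := by
    rw [Complex.cos_eq]; push_cast; ring
  have hre : (Complex.cos z).re = Real.cos z.re * Real.cosh z.im := by
    rw [h]; simp only [Complex.add_re, Complex.mul_re, Complex.ofReal_re, Complex.ofReal_im,
      Complex.I_re, Complex.I_im]; ring
  have him : (Complex.cos z).im = -(Real.sin z.re * Real.sinh z.im) := by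
    rw [h]; simp only [Complex.add_im, Complex.mul_im, Complex.ofReal_re, Complex.ofReal_im,
      Complex.I_re, Complex.I_im]; ring
  rw [Complex.sq_norm, Complex.normSq_apply, hre, him]
  have h1 := Real.cos_sq_add_sin_sq z.re
  have h2 : Real.cosh z.im ^ 2 = Real.sinh z.im ^ 2 + 1 := Real.cosh_sq z.im
  nlinarith [h1, h2]

/-- `|sin(re z)| ≤ ‖sin z‖`; in particular `sin z ≠ 0` off the lines `re z ∈ ℤ`. [folklore] -/
theorem abs_sin_re_le_norm_sin (z : ℂ) : |Real.sin z.re| ≤ ‖Complex.sin z‖ := by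
  have hsq : Real.sin z.re ^ 2 ≤ ‖Complex.sin z‖ ^ 2 := by
    rw [norm_sin_sq_eq]; nlinarith [sq_nonneg (Real.sinh z.im)]
  exact abs_le.2 (abs_le_of_sq_le_sq' hsq (norm_nonneg _))

/-- On a vertical line `re z = x` with `sin x ≠ 0`: `‖cos z / sin z‖ ≤ 1/|sin x|`
(`(cos²x + sinh²y)/(sin²x + sinh²y) ≤ 1/sin²x`). [folklore] -/
theorem norm_cos_div_sin_le_inv_abs_sin (z : ℂ) (hz : Real.sin z.re ≠ 0) :
    ‖Complex.cos z / Complex.sin z‖ ≤ |Real.sin z.re|⁻¹ := by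
  have hs0 : 0 < |Real.sin z.re| := abs_pos.2 hz
  have hsn : 0 < ‖Complex.sin z‖ := hs0.trans_le (abs_sin_re_le_norm_sin z)
  rw [norm_div, div_le_iff₀ hsn, ← div_eq_inv_mul, le_div_iff₀ hs0]
  -- `‖cos z‖ |sin x| ≤ ‖sin z‖`, compare squares
  have h1 : (‖Complex.cos z‖ * |Real.sin z.re|) ^ 2 ≤ ‖Complex.sin z‖ ^ 2 := by
    rw [mul_pow, sq_abs, norm_cos_sq_eq, norm_sin_sq_eq]
    have hc := Real.cos_sq_add_sin_sq z.re
    have hs1 : Real.sin z.re ^ 2 ≤ 1 := Real.sin_sq_le_one z.re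
    nlinarith [sq_nonneg (Real.sinh z.im), sq_nonneg (Real.cos z.re), hs1]
  exact (abs_le_of_sq_le_sq' h1 (norm_nonneg _)).2

/-- Far from the real axis `cot` is bounded: `‖cos z / sin z‖ ≤ 2` for `|im z| ≥ 1`
(`cosh² y ≤ 4 sinh² y` there). [folklore] -/
theorem norm_cos_div_sin_le_two (z : ℂ) (hz : 1 ≤ |z.im|) : ‖Complex.cos z / Complex.sin z‖ ≤ 2 := by
  have hsh : 1 ≤ |Real.sinh z.im| := by
    rw [Real.abs_sinh]
    exact hz.trans (Real.self_le_sinh_iff.2 (abs_nonneg _))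
  have hsn : 0 < ‖Complex.sin z‖ :=
    (zero_lt_one.trans_le hsh).trans_le (Literature.Analysis.SpecialFunctions.abs_sinh_im_le_norm_sin z)
  rw [norm_div, div_le_iff₀ hsn]
  have h1 : ‖Complex.cos z‖ ^ 2 ≤ (2 * ‖Complex.sin z‖) ^ 2 := by
    rw [mul_pow, norm_cos_sq_eq, norm_sin_sq_eq]
    have hc1 : Real.cos z.re ^ 2 ≤ 1 := Real.cos_sq_le_one z.re
    have hsq : 1 ≤ Real.sinh z.im ^ 2 := by
      have := sq_abs (Real.sinh z.im); nlinarith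
    nlinarith [sq_nonneg (Real.sin z.re)]
  exact (abs_le_of_sq_le_sq' h1 (by positivity)).2

end Literature.Analysis.Complex
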